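import Summits.BirchSwinnertonDyer.BirchSwinnertonDyer.Theorems.ManinLocalTwoThreeStevensCuspRational
import Summits.BirchSwinnertonDyer.BirchSwinnertonDyer.Theorems.ManinLocalTwoThreeFlatGamma1Datum
import Summits.BirchSwinnertonDyer.BirchSwinnertonDyer.Theorems.ManinLocalTwoThreeCuspValuesOfTranslates
import Literature.NumberTheory.EllipticCurves.ModularParametrizationCuspGalois
import HarnessLib

/-!
# Stevens 1982 Thm 1.3.1 (a)+(b) for `X₀(N)`-parametrisations at ALL cusps (`optimalParametrization_cusp_cyclotomic_galois` holds)
(route `ManinLocalTwoThree`, crux C2 `ManinOddAtFour` stmt-BirchSwinnertonDyer-22967; cell bsd-f2-manin, LEAD prover p1 gen 22;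
`--supports stmt-BirchSwinnertonDyer-22967`)

THEOREM (`optimalParametrization_cusp_cyclotomic_galois_holds`, the named fact of `Literature…ModularParametrizationCuspGalois`; its lattice
clause is not used).  For an elliptic `W/ℚ` with an `X₀(N)`-datum `D` and a cusp `x/y` in lowest terms: (a) `u(c·{∞,x/y}_f)` is the base change of
a point `P ∈ W(ℚ(ζ_N))`; (b) for `τ ∈ Aut(ℚ(ζ_N))` with `τ(ζ_N) = ζ_N^d`, `dd′ ≡ 1 (N)` and `(x, d′y) = 1`, `τ(P)` base-changes to `u(c·{∞,x/(d′y)}_f)`.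

PROOF.  View `D` as an `X₁(N)`-datum (`FlatGamma1Datum.exists_gamma1ParametrizationData_of_datum`) and run Stevens (b) for general pairs
(`StevensGalois.map_uniformize_cusp_general`, from the Galois action on `q_N`-expansions of translates) with `γ = (x,b;y,δ)` and a lift `γ′`
of `diag(1,d′)γdiag(1,d)` off `∞`; then move from the cusp `γ′∞` to the cusp `x/(d′y)` with the same first column mod `N` by an element of
`Γ(N)` (`exists_gamma_mul_eq_mul_T_zpow`), resp. to the cusp `0` by an element of `Γ₀(N)` when `y = 0` or `N = 1`, using Manin's cocycle in
the form `{∞,(ηg)∞}_f = {∞,η∞}_f + {∞,g∞}_f` (`modularSymbol_gamma0_mul`, `η ∈ Γ₀(N)`) and `c·{∞,η∞}_f ∈ cΛ_f ⊆ Λ_W`.  Rationality over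
`ℚ(ζ_N)` is the case `d = d′ = 1` plus the fixed-field theorem (`ComplexAut.mem_adjoin_simple_of_forall_algEquiv`); `τ` extends to `ℂ` by
`ComplexAut.exists_complex_algEquiv_extends`.

HONEST FRAMING.  Discharges a named Literature fact (statement-only so far).  Nothing about C2, Manin's conjecture or BSD is proved here.
[cite: Stevens1982, §1.3 Thm. 1.3.1 (a), (b) (p. 13)] [cite: Manin1972, Prop. 1.4] [cite: ShimuraIATAF1971, Lemma 1.38, §6.2]
-/

-- lint-debt: the directory name repeats the summit name (sibling precedent `ManinLocalTwoThreeStevensCuspInvGaloisAction.lean`)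
set_option linter.dupNamespace false
set_option autoImplicit false

noncomputable section

open Complex Filter Topology
open UpperHalfPlane hiding I
open scoped Real MatrixGroups PeriodPair
open CongruenceSubgroup
open Literature.NumberTheory.EllipticCurves Literature.NumberTheory.EllipticCurves.ModularForms

namespace Summit.BirchSwinnertonDyer.BirchSwinnertonDyer.Theorems.ManinLocalTwoThree.StevensGalois

variable {N : ℕ} [NeZero N]

/-! ## §1 Manin's cocycle for a translate by `Γ₀(N)` and the value at equivalent cusps -/

/-- **`{∞, (ηg)∞}_f = {∞, η∞}_f + {∞, g∞}_f`** for `η ∈ Γ₀(N)` and `g ∈ SL₂(ℤ)` with `g∞, ηg∞ ≠ ∞`: both sides are the limit of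
`ℰ_f(ηgτ) = ℰ_f(gτ) + {∞,η∞}_f` as `im τ → ∞`. [cite: Manin1972, Prop. 1.4] -/
theorem modularSymbol_gamma0_mul (f : CuspForm (Gamma0 N) 2) (η : Gamma0 N) (g : SL(2, ℤ)) (hg : (g 1 0 : ℤ) ≠ 0)
    (hηg : (((η : SL(2, ℤ)) * g) 1 0 : ℤ) ≠ 0) :
    modularSymbol f (((((η : SL(2, ℤ)) * g) 0 0 : ℤ) : ℚ) / ((((η : SL(2, ℤ)) * g) 1 0 : ℤ) : ℚ)) =
      cuspSymbol f η + modularSymbol f (((g 0 0 : ℤ) : ℚ) / ((g 1 0 : ℤ) : ℚ)) := by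
  have h1 := CuspValues.tendsto_eichlerIntegral_smul_atImInfty f ((η : SL(2, ℤ)) * g) hηg
  have h2 := CuspValues.tendsto_eichlerIntegral_smul_atImInfty f g hg
  have h3 : Tendsto (fun τ : ℍ ↦ eichlerIntegral f (((η : SL(2, ℤ)) * g) • τ)) atImInfty
      (𝓝 (cuspSymbol f η + modularSymbol f (((g 0 0 : ℤ) : ℚ) / ((g 1 0 : ℤ) : ℚ)))) := by
    have e : (fun τ : ℍ ↦ eichlerIntegral f (((η : SL(2, ℤ)) * g) • τ)) =
        fun τ ↦ eichlerIntegral f (g • τ) + cuspSymbol f η := by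
      funext τ
      rw [mul_smul, ← eichlerIntegral_smul_sub_holds f η (g • τ)]
      ring
    rw [e, add_comm (cuspSymbol f η)]
    exact h2.add_const _
  exact tendsto_nhds_unique h1 h3

omit [NeZero N] in
/-- First column of `γ T^t` is that of `γ`. [folklore] -/
private theorem mul_T_zpow_col (γ : SL(2, ℤ)) (t : ℤ) :
    ((γ * ModularGroup.T ^ t) 0 0 : ℤ) = γ 0 0 ∧ ((γ * ModularGroup.T ^ t) 1 0 : ℤ) = γ 1 0 := by
  constructor <;>
    simp [Matrix.SpecialLinearGroup.coe_mul, ModularGroup.coe_T_zpow, Matrix.mul_apply, Fin.sum_univ_two]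

/-- **Values at `Γ₀(N)`-equivalent cusps agree**: for an `X₀(N)`-datum `D` and `γ′, γ″ ∈ SL₂(ℤ)` off `∞` with `ηγ″ = γ′T^t` for some
`η ∈ Γ₀(N)`, `u(c·{∞,γ′∞}_f) = u(c·{∞,γ″∞}_f)` (Manin's cocycle and `c·{∞,η∞}_f ∈ cΛ_f ⊆ Λ_W`). [cite: Manin1972, Prop. 1.4] -/
theorem uniformize_cusp_eq_of_gamma0 {W : WeierstrassCurve ℚ} (D : ModularParametrizationData W N) (γ' γ'' : SL(2, ℤ))
    (hγ'10 : (γ' 1 0 : ℤ) ≠ 0) (hγ''10 : (γ'' 1 0 : ℤ) ≠ 0) (η : Gamma0 N) (t : ℤ)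
    (h : (η : SL(2, ℤ)) * γ'' = γ' * ModularGroup.T ^ t) :
    D.uniformize ((D.c : ℂ) * modularSymbol D.f (((γ' 0 0 : ℤ) : ℚ) / ((γ' 1 0 : ℤ) : ℚ))) =
      D.uniformize ((D.c : ℂ) * modularSymbol D.f (((γ'' 0 0 : ℤ) : ℚ) / ((γ'' 1 0 : ℤ) : ℚ))) := by
  obtain ⟨e0, e1⟩ := mul_T_zpow_col γ' t
  have hηg : (((η : SL(2, ℤ)) * γ'') 1 0 : ℤ) ≠ 0 := by rw [h, e1]; exact hγ'10
  have hcoc := modularSymbol_gamma0_mul D.f η γ'' hγ''10 hηg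
  rw [h, e0, e1] at hcoc
  rw [hcoc, mul_add, map_add]
  have hmem : (D.c : ℂ) * cuspSymbol D.f η ∈ D.L.lattice := D.smul_periodLattice_le _ (cuspSymbol_mem_periodLattice D.f η)
  have hker : D.uniformize ((D.c : ℂ) * cuspSymbol D.f η) = 0 := by
    rw [← AddMonoidHom.mem_ker, ← SetLike.mem_coe, D.ker_uniformize]
    exact hmem
  rw [hker, zero_add]

/-! ## §2 Cusp equivalences -/

omit [NeZero N] in
/-- Entries of `γ′⁻¹γ″`. [folklore] -/
private theorem inv_mul_entries (γ' γ'' : SL(2, ℤ)) :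
    ((γ'⁻¹ * γ'') 0 0 : ℤ) = γ' 1 1 * γ'' 0 0 - γ' 0 1 * γ'' 1 0 ∧
    ((γ'⁻¹ * γ'') 0 1 : ℤ) = γ' 1 1 * γ'' 0 1 - γ' 0 1 * γ'' 1 1 ∧
    ((γ'⁻¹ * γ'') 1 0 : ℤ) = -(γ' 1 0 * γ'' 0 0) + γ' 0 0 * γ'' 1 0 ∧
    ((γ'⁻¹ * γ'') 1 1 : ℤ) = -(γ' 1 0 * γ'' 0 1) + γ' 0 0 * γ'' 1 1 := by
  simp only [Matrix.SpecialLinearGroup.coe_mul, Matrix.SpecialLinearGroup.coe_inv, Matrix.adjugate_fin_two,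
    Matrix.mul_apply, Fin.sum_univ_two, Matrix.of_apply, Matrix.cons_val', Matrix.cons_val_zero, Matrix.cons_val_one,
    Matrix.empty_val', Matrix.cons_val_fin_one]
  refine ⟨by ring, by ring, by ring, by ring⟩

omit [NeZero N] in
/-- **Cusps with the same first column mod `N` differ by `Γ(N)`**: if `γ′₀₀ ≡ γ″₀₀` and `γ′₁₀ ≡ γ″₁₀ (mod N)` then `ηγ″ = γ′T^t` for some
`η ∈ Γ(N)`, `t ∈ ℤ` (`γ′⁻¹γ″` fixes `e₁` mod `N`, hence is `≡ T^t`). [cite: ShimuraIATAF1971, Lemma 1.38 and §1.6] -/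
theorem exists_gamma_mul_eq_mul_T_zpow (γ' γ'' : SL(2, ℤ)) (h0 : ((γ' 0 0 : ℤ) : ZMod N) = ((γ'' 0 0 : ℤ) : ZMod N))
    (h1 : ((γ' 1 0 : ℤ) : ZMod N) = ((γ'' 1 0 : ℤ) : ZMod N)) :
    ∃ (η : SL(2, ℤ)) (t : ℤ), η ∈ CongruenceSubgroup.Gamma N ∧ η * γ'' = γ' * ModularGroup.T ^ t := by
  set M : SL(2, ℤ) := γ'⁻¹ * γ'' with hM
  obtain ⟨m00, m01, m10, m11⟩ := inv_mul_entries γ' γ''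
  have hdet' : (γ' 0 0 : ℤ) * γ' 1 1 - γ' 0 1 * γ' 1 0 = 1 := by rw [← Matrix.det_fin_two, γ'.det_coe]
  have hdetM : (M 0 0 : ℤ) * M 1 1 - M 0 1 * M 1 0 = 1 := by rw [← Matrix.det_fin_two, M.det_coe]
  have hM00 : ((M 0 0 : ℤ) : ZMod N) = 1 := by
    rw [hM, m00]; push_cast; rw [← h0, ← h1]
    have := congrArg (fun z : ℤ ↦ (z : ZMod N)) hdet'
    push_cast at this
    linear_combination this
  have hM10 : ((M 1 0 : ℤ) : ZMod N) = 0 := by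
    rw [hM, m10]; push_cast; rw [← h0, ← h1]; ring
  have hM11 : ((M 1 1 : ℤ) : ZMod N) = 1 := by
    have := congrArg (fun z : ℤ ↦ (z : ZMod N)) hdetM
    push_cast at this
    rw [hM00, hM10] at this
    linear_combination this
  refine ⟨γ' * ModularGroup.T ^ (M 0 1 : ℤ) * γ''⁻¹, M 0 1, ?_, by group⟩
  -- `γ′ T^t γ″⁻¹ = γ′ (T^t M⁻¹) γ′⁻¹` reduces to `1` mod `N`
  have hTM : Matrix.SpecialLinearGroup.map (Int.castRingHom (ZMod N)) (ModularGroup.T ^ (M 0 1 : ℤ)) =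
      Matrix.SpecialLinearGroup.map (Int.castRingHom (ZMod N)) M := by
    ext i j
    rw [Literature.NumberTheory.ModularForms.specialLinearGroup_map_apply,
      Literature.NumberTheory.ModularForms.specialLinearGroup_map_apply]
    have hT : ∀ i j : Fin 2, ((ModularGroup.T ^ (M 0 1 : ℤ)) i j : ℤ) = !![(1 : ℤ), (M 0 1 : ℤ); 0, 1] i j := fun i j ↦ by
      rw [← ModularGroup.coe_T_zpow]
    rw [hT]
    fin_cases i <;> fin_cases j <;> simp [hM00, hM10, hM11]
  have hγ'' : γ'' = γ' * M := by rw [hM, mul_inv_cancel_left]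
  rw [CongruenceSubgroup.Gamma_mem', hγ'']
  simp only [map_mul, map_inv, hTM]
  group

omit [NeZero N] in
/-- **A cusp `γ′∞` with `γ′₁₁ + kγ′₁₀ ≡ 0 (mod N)` is `Γ₀(N)`-equivalent to `0 = S∞`**: `ηS = γ′T^k` with `η = γ′T^kS⁻¹ ∈ Γ₀(N)`.
[cite: ShimuraIATAF1971, §1.6] -/
theorem exists_gamma0_mul_S_eq (γ' : SL(2, ℤ)) (k : ℤ) (hk : (((γ' 1 1 : ℤ) + k * γ' 1 0 : ℤ) : ZMod N) = 0) :
    ∃ η : Gamma0 N, (η : SL(2, ℤ)) * ModularGroup.S = γ' * ModularGroup.T ^ k := by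
  have h10 : ((γ' * ModularGroup.T ^ k * ModularGroup.S⁻¹) 1 0 : ℤ) = -((γ' 1 1 : ℤ) + k * γ' 1 0) := by
    simp [Matrix.SpecialLinearGroup.coe_mul, Matrix.SpecialLinearGroup.coe_inv, ModularGroup.coe_T_zpow, ModularGroup.coe_S,
      Matrix.adjugate_fin_two, Matrix.mul_apply, Fin.sum_univ_two]
    ring
  refine ⟨⟨γ' * ModularGroup.T ^ k * ModularGroup.S⁻¹, ?_⟩, by simp⟩
  rw [Gamma0_mem, h10]
  push_cast at hk ⊢
  rw [hk, neg_zero]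

/-! ## §3 The named fact -/

/-- **`optimalParametrization_cusp_cyclotomic_galois` HOLDS** (Stevens 1982 Thm 1.3.1 (a)+(b) for `X₀(N)`-parametrisations at every cusp
`x/y`, as typed; the lattice clause is unused). [cite: Stevens1982, §1.3 Thm. 1.3.1 (a), (b) (p. 13)] -/
theorem optimalParametrization_cusp_cyclotomic_galois_holds : optimalParametrization_cusp_cyclotomic_galois := by
  intro W _ N _ D _ x y hxy
  classical
  obtain ⟨D₁, hf, hL, hu, hc⟩ := FlatGamma1Datum.exists_gamma1ParametrizationData_of_datum D
  -- a matrix `g` off `∞` with `g∞ = x/y` (as a rational number: `x/0 = 0 = S∞`)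
  obtain ⟨g, hg10, hgq⟩ : ∃ g : SL(2, ℤ), (g 1 0 : ℤ) ≠ 0 ∧ ((g 0 0 : ℤ) : ℚ) / ((g 1 0 : ℤ) : ℚ) = (x : ℚ) / y := by
    by_cases hy : y = 0
    · refine ⟨ModularGroup.S, by simp [ModularGroup.S], ?_⟩
      simp [ModularGroup.S, hy]
    · have hb : x * Int.gcdA x y + y * Int.gcdB x y = 1 := by
        rw [← Int.gcd_eq_gcd_ab, show Int.gcd x y = 1 from hxy]; rfl
      refine ⟨⟨!![x, -Int.gcdB x y; y, Int.gcdA x y], ?_⟩, by simpa using hy, by simp⟩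
      rw [Matrix.det_fin_two_of]; linear_combination hb
  -- Stevens (b) for the `X₁(N)`-datum, read on `D`
  have hT : ∀ (σ : ℂ ≃ₐ[ℚ] ℂ) {d d' : ℤ} (hdd : ((d * d' : ℤ) : ZMod N) = 1)
      (hσ : σ (cexp (2 * π * Complex.I / N)) = cexp (2 * π * Complex.I * d / N)) (γ' : SL(2, ℤ)) (hγ'10 : (γ' 1 0 : ℤ) ≠ 0)
      (h00 : ((γ' 0 0 : ℤ) : ZMod N) = ((g 0 0 : ℤ) : ZMod N))
      (h01 : ((γ' 0 1 : ℤ) : ZMod N) = (d : ZMod N) * ((g 0 1 : ℤ) : ZMod N))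
      (h10 : ((γ' 1 0 : ℤ) : ZMod N) = (d' : ZMod N) * ((g 1 0 : ℤ) : ZMod N))
      (h11 : ((γ' 1 1 : ℤ) : ZMod N) = ((g 1 1 : ℤ) : ZMod N)),
      WeierstrassCurve.Affine.Point.map (W' := W) (σ : ℂ →ₐ[ℚ] ℂ) (D.uniformize ((D.c : ℂ) * modularSymbol D.f ((x : ℚ) / y))) =
        D.uniformize ((D.c : ℂ) * modularSymbol D.f (((γ' 0 0 : ℤ) : ℚ) / ((γ' 1 0 : ℤ) : ℚ))) := by
    intro σ d d' hdd hσ γ' hγ'10 h00 h01 h10 h11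
    have h := map_uniformize_cusp_general D₁ σ hdd hσ g γ' hg10 hγ'10 h00 h01 h10 h11
    rw [hf, hu, hc, hgq] at h
    exact h
  -- (a) descent to `ℚ(ζ_N)`: `d = d′ = 1`, `γ′ = g`
  have hfix : ∀ σ : ℂ ≃ₐ[ℚ] ℂ, σ (rootOfUnityExp N) = rootOfUnityExp N →
      WeierstrassCurve.Affine.Point.map (W' := W) (σ : ℂ →ₐ[ℚ] ℂ) (D.uniformize ((D.c : ℂ) * modularSymbol D.f ((x : ℚ) / y))) =
        D.uniformize ((D.c : ℂ) * modularSymbol D.f ((x : ℚ) / y)) := by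
    intro σ hσ
    have hσ' : σ (cexp (2 * π * Complex.I / N)) = cexp (2 * π * Complex.I * ((1 : ℤ) : ℂ) / N) := by
      rw [Int.cast_one, mul_one]; exact hσ
    have h := hT σ (d := 1) (d' := 1) (by simp) hσ' g hg10 rfl (by simp) (by simp) rfl
    rwa [hgq] at h
  have hdesc : ∃ P : (W.baseChange (cyclotomicSubfield N)).toAffine.Point,
      WeierstrassCurve.Affine.Point.baseChange (W' := W) (cyclotomicSubfield N) ℂ P =
        D.uniformize ((D.c : ℂ) * modularSymbol D.f ((x : ℚ) / y)) := by
    rcases hPt : D.uniformize ((D.c : ℂ) * modularSymbol D.f ((x : ℚ) / y)) with _ | ⟨xv, yv, hns⟩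
    · exact ⟨0, rfl⟩
    · have hco : ∀ σ : ℂ ≃ₐ[ℚ] ℂ, σ (rootOfUnityExp N) = rootOfUnityExp N → σ xv = xv ∧ σ yv = yv := by
        intro σ hσ
        have h := hfix σ hσ
        have eσ : ∀ w : ℂ, (σ : ℂ →ₐ[ℚ] ℂ) w = σ w := fun _ ↦ rfl
        rw [hPt, WeierstrassCurve.Affine.Point.map_some] at h
        simpa only [WeierstrassCurve.Affine.Point.some.injEq, eσ] using h
      have hx : xv ∈ cyclotomicSubfield N :=
        ComplexAut.mem_adjoin_simple_of_forall_algEquiv (rootOfUnityExp N) fun σ hσ ↦ (hco σ hσ).1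
      have hyv : yv ∈ cyclotomicSubfield N :=
        ComplexAut.mem_adjoin_simple_of_forall_algEquiv (rootOfUnityExp N) fun σ hσ ↦ (hco σ hσ).2
      have hns' : (W.baseChange (cyclotomicSubfield N)).toAffine.Nonsingular ⟨xv, hx⟩ ⟨yv, hyv⟩ :=
        (WeierstrassCurve.Affine.baseChange_nonsingular (W := W.toAffine) (f := Algebra.ofId (cyclotomicSubfield N) ℂ)
          Subtype.val_injective (⟨xv, hx⟩ : cyclotomicSubfield N) ⟨yv, hyv⟩).mp hns
      exact ⟨WeierstrassCurve.Affine.Point.some _ _ hns', rfl⟩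
  obtain ⟨P, hP⟩ := hdesc
  refine ⟨P, hP, ?_⟩
  -- (b) the Galois action
  intro d d' hdd hxy' τ hτ
  obtain ⟨σ, hσ⟩ := ComplexAut.exists_complex_algEquiv_extends (cyclotomicSubfield N) τ
  have hσζ : σ (cexp (2 * π * Complex.I / N)) = cexp (2 * π * Complex.I * ((d : ℤ) : ℂ) / N) := by
    have e : rootOfUnityExp N ^ d = cexp (2 * π * Complex.I * ((d : ℤ) : ℂ) / N) := by
      rw [rootOfUnityExp, ← Complex.exp_nat_mul]; congr 1; push_cast; ring
    rw [← e, ← hτ]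
    exact hσ (zetaGen N)
  have hdd' : (((d : ℤ) * d' : ℤ) : ZMod N) = 1 := by
    rw [show (1 : ZMod N) = ((1 : ℤ) : ZMod N) by simp]
    exact (ZMod.intCast_eq_intCast_iff _ _ _).mpr hdd
  -- the lift `γ′` of `diag(1,d′) g diag(1,d)` off `∞`
  have hdetg : (g 0 0 : ℤ) * g 1 1 - g 0 1 * g 1 0 = 1 := by rw [← Matrix.det_fin_two, g.det_coe]
  have hdetM : Matrix.det !![((g 0 0 : ℤ) : ZMod N), ((d : ℤ) : ZMod N) * ((g 0 1 : ℤ) : ZMod N);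
      (d' : ZMod N) * ((g 1 0 : ℤ) : ZMod N), ((g 1 1 : ℤ) : ZMod N)] = 1 := by
    have h1 := congrArg (fun z : ℤ ↦ (z : ZMod N)) hdetg
    simp only [Int.cast_sub, Int.cast_mul, Int.cast_one] at h1
    have h2 : ((d : ℤ) : ZMod N) * (d' : ZMod N) = 1 := by exact_mod_cast hdd'
    rw [Matrix.det_fin_two_of]
    linear_combination h1 - (((g 0 1 : ℤ) : ZMod N) * ((g 1 0 : ℤ) : ZMod N)) * h2
  obtain ⟨γ', hγ'M, hγ'10⟩ := exists_lift_lowerLeft_ne_zero (N := N) ⟨_, hdetM⟩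
  have hent : ∀ i j : Fin 2, ((γ' i j : ℤ) : ZMod N) =
      !![((g 0 0 : ℤ) : ZMod N), ((d : ℤ) : ZMod N) * ((g 0 1 : ℤ) : ZMod N);
        (d' : ZMod N) * ((g 1 0 : ℤ) : ZMod N), ((g 1 1 : ℤ) : ZMod N)] i j := by
    intro i j
    have h := congrArg (fun m : SL(2, ZMod N) ↦ (m : Matrix (Fin 2) (Fin 2) (ZMod N)) i j) hγ'M
    simpa using h
  have h00 : ((γ' 0 0 : ℤ) : ZMod N) = ((g 0 0 : ℤ) : ZMod N) := by simpa using hent 0 0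
  have h01 : ((γ' 0 1 : ℤ) : ZMod N) = ((d : ℤ) : ZMod N) * ((g 0 1 : ℤ) : ZMod N) := by simpa using hent 0 1
  have h10 : ((γ' 1 0 : ℤ) : ZMod N) = (d' : ZMod N) * ((g 1 0 : ℤ) : ZMod N) := by simpa using hent 1 0
  have h11 : ((γ' 1 1 : ℤ) : ZMod N) = ((g 1 1 : ℤ) : ZMod N) := by simpa using hent 1 1
  have hval := hT σ hdd' hσζ γ' hγ'10 h00 h01 h10 h11
  -- `τ(P)` base-changes to `σ` of the value
  have hmapP : WeierstrassCurve.Affine.Point.baseChange (W' := W) (cyclotomicSubfield N) ℂ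
      (WeierstrassCurve.Affine.Point.map (W' := W) (τ : cyclotomicSubfield N →ₐ[ℚ] cyclotomicSubfield N) P) =
      WeierstrassCurve.Affine.Point.map (W' := W) (σ : ℂ →ₐ[ℚ] ℂ)
        (WeierstrassCurve.Affine.Point.baseChange (W' := W) (cyclotomicSubfield N) ℂ P) := by
    rcases P with _ | ⟨xk, yk, hk⟩
    · rfl
    · change WeierstrassCurve.Affine.Point.map _ (WeierstrassCurve.Affine.Point.map _ _) =
        WeierstrassCurve.Affine.Point.map _ (WeierstrassCurve.Affine.Point.map _ _)
      rw [WeierstrassCurve.Affine.Point.map_some, WeierstrassCurve.Affine.Point.map_some,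
        WeierstrassCurve.Affine.Point.map_some, WeierstrassCurve.Affine.Point.map_some]
      simp only [WeierstrassCurve.Affine.Point.some.injEq]
      exact ⟨(hσ xk).symm, (hσ yk).symm⟩
  rw [hmapP, hP, hval]
  -- move from the cusp `γ′∞` to the cusp `x/(d′y)` of the statement
  by_cases hy0 : (d' : ℤ) * y = 0
  · -- target cusp `0 = S∞`; here `γ′₁₀ ≡ d′y ≡ 0`... no: `γ′₁₀ ≡ d′ g₁₀`, and `γ′₁₁ γ′₀₀ ≡ 1`
    have htarget : ((x : ℚ) / (d' * y)) = (((ModularGroup.S : SL(2, ℤ)) 0 0 : ℤ) : ℚ) / (((ModularGroup.S : SL(2, ℤ)) 1 0 : ℤ) : ℚ) := by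
      have : ((d' : ℚ) * y) = 0 := by exact_mod_cast hy0
      simp [ModularGroup.S, this]
    rw [htarget]
    -- `γ′₁₀` is invertible mod `N`: from `d′y = 0` either `d′ = 0` (then `N ∣ 1`) or `y = 0` (then `g = S`-like: `g₁₀ ≡ ±1`?) — we use
    -- `k := -γ′₁₁ · d · w` where `w` inverts `g₁₀` resp. everything vanishes mod `1`.
    rcases mul_eq_zero.mp hy0 with hd0 | hy
    · -- `d′ = 0`: `N ∣ 1`
      have hN1 : (1 : ZMod N) = 0 := by
        have := hdd'; rw [hd0, mul_zero, Int.cast_zero] at this; exact this.symm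
      haveI : Subsingleton (ZMod N) := subsingleton_of_zero_eq_one hN1.symm
      obtain ⟨η, hη⟩ := exists_gamma0_mul_S_eq (N := N) γ' 0 (Subsingleton.elim _ _)
      exact uniformize_cusp_eq_of_gamma0 D γ' ModularGroup.S hγ'10 (by simp [ModularGroup.S]) η 0 hη
    · -- `y = 0`: then `x = ±1`... we only need `g₁₀ ≡` a unit: `g∞ = x/0 = 0` was realised by `g = S`, but `g` is opaque here, so use
      -- `gcd(x, y) = 1` with `y = 0`: `g 0 0 / g 1 0 = 0`, i.e. `g 0 0 = 0`, whence `-g 0 1 * g 1 0 = 1`.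
      have hg00 : (g 0 0 : ℤ) = 0 := by
        have h := hgq; rw [hy, Int.cast_zero, div_zero, div_eq_zero_iff] at h
        rcases h with h | h
        · exact_mod_cast h
        · exact absurd (by exact_mod_cast h) hg10
      have hunit : -((g 0 1 : ℤ) : ZMod N) * ((g 1 0 : ℤ) : ZMod N) = 1 := by
        have h1 : ((g 0 0 : ℤ) : ZMod N) * ((g 1 1 : ℤ) : ZMod N) - ((g 0 1 : ℤ) : ZMod N) * ((g 1 0 : ℤ) : ZMod N) = 1 := by
          exact_mod_cast congrArg (fun z : ℤ ↦ (z : ZMod N)) hdetg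
        rw [hg00, Int.cast_zero, zero_mul, zero_sub] at h1
        linear_combination h1
      -- `k := γ′₁₁ · g₀₁ · d` works: `γ′₁₁ + k γ′₁₀ ≡ γ′₁₁ (1 + g₀₁ d d′ g₁₀) ≡ γ′₁₁ (1 - 1) = 0`
      obtain ⟨η, hη⟩ := exists_gamma0_mul_S_eq (N := N) γ' ((γ' 1 1 : ℤ) * g 0 1 * d) (by
        push_cast
        rw [h10]
        have h2 : (d : ZMod N) * (d' : ZMod N) = 1 := by exact_mod_cast hdd'
        linear_combination (((γ' 1 1 : ℤ) : ZMod N)) * (((g 0 1 : ℤ) : ZMod N) * ((g 1 0 : ℤ) : ZMod N)) * h2 -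
          (((γ' 1 1 : ℤ) : ZMod N)) * hunit)
      exact uniformize_cusp_eq_of_gamma0 D γ' ModularGroup.S hγ'10 (by simp [ModularGroup.S]) η _ hη
  · -- target cusp `x/(d′y)` with `(x, d′y) = 1`: the matrix `γ″ = (x, ·; d′y, ·)`
    have hb : x * Int.gcdA x (d' * y) + d' * y * Int.gcdB x (d' * y) = 1 := by
      rw [← Int.gcd_eq_gcd_ab, show Int.gcd x (d' * y) = 1 from hxy']; rfl
    set γ'' : SL(2, ℤ) := ⟨!![x, -Int.gcdB x (d' * y); d' * y, Int.gcdA x (d' * y)], by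
      rw [Matrix.det_fin_two_of]; linear_combination hb⟩ with hγ''def
    have hγ''10 : (γ'' 1 0 : ℤ) ≠ 0 := by simpa [hγ''def] using hy0
    have htarget : ((x : ℚ) / (d' * y)) = ((γ'' 0 0 : ℤ) : ℚ) / ((γ'' 1 0 : ℤ) : ℚ) := by simp [hγ''def]
    rw [htarget]
    -- first columns agree mod `N`: `γ′₀₀ ≡ g₀₀`, `γ′₁₀ ≡ d′ g₁₀` versus `(x, d′y)`; and `(g₀₀, g₁₀) = (x, y)` up to the common
    -- description `g₀₀/g₁₀ = x/y` — we need the entries themselves: recover them from `hgq` and coprimality.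
    have hy : y ≠ 0 := fun h ↦ hy0 (by rw [h, mul_zero])
    -- from `g₀₀/g₁₀ = x/y`, `gcd(x,y) = 1` and `gcd(g₀₀,g₁₀) = 1`: `(g₀₀, g₁₀) = ±(x, y)`
    have hcross : (g 0 0 : ℤ) * y = x * g 1 0 := by
      have h := hgq
      rw [div_eq_div_iff (by exact_mod_cast hg10) (by exact_mod_cast hy)] at h
      exact_mod_cast h
    have hgcop : IsCoprime (g 0 0 : ℤ) (g 1 0) := ⟨g 1 1, -g 0 1, by linear_combination hdetg⟩
    have hxcop : IsCoprime x y := by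
      rw [Int.isCoprime_iff_gcd_eq_one]; exact hxy
    obtain ⟨u, hu1, hux, huy⟩ : ∃ u : ℤ, (u = 1 ∨ u = -1) ∧ (g 0 0 : ℤ) = u * x ∧ (g 1 0 : ℤ) = u * y := by
      -- `x ∣ g₀₀ y` with `gcd(x,y)=1` ⟹ `x ∣ g₀₀`; symmetric ⟹ `g₀₀ = u x`, then `g₁₀ = u y`
      have hx0 : x ≠ 0 ∨ y ≠ 0 := Or.inr hy
      have hdvd1 : x ∣ (g 0 0 : ℤ) := by
        have : x ∣ (g 0 0 : ℤ) * y := ⟨g 1 0, by rw [hcross]⟩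
        exact hxcop.dvd_of_dvd_mul_right this
      have hdvd2 : (g 0 0 : ℤ) ∣ x := by
        have : (g 0 0 : ℤ) ∣ x * g 1 0 := ⟨y, by rw [← hcross]⟩
        exact hgcop.dvd_of_dvd_mul_right this
      by_cases hx : x = 0
      · -- then `g₀₀ = 0`, `y = ±1`, `g₁₀ = ±1`
        have hg00 : (g 0 0 : ℤ) = 0 := by simpa [hx] using hdvd1
        have hy1 : y = 1 ∨ y = -1 := by
          have : Int.gcd 0 y = 1 := by simpa [hx] using hxy
          rw [Int.gcd_zero_left] at this
          rcases Int.natAbs_eq y with h | h <;> [left; right] <;> omega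
        have hg1 : (g 1 0 : ℤ) = 1 ∨ (g 1 0 : ℤ) = -1 := by
          have h := Int.isCoprime_iff_gcd_eq_one.mp hgcop
          rw [hg00, Int.gcd_zero_left] at h
          rcases Int.natAbs_eq (g 1 0 : ℤ) with h' | h' <;> [left; right] <;> omega
        refine ⟨(g 1 0 : ℤ) * y, ?_, by rw [hg00, hx, mul_zero], ?_⟩
        · rcases hy1 with h | h <;> rcases hg1 with h' | h' <;> simp [h, h']
        · rcases hy1 with h | h <;> simp [h]
      · obtain ⟨u, hu⟩ := hdvd1
        obtain ⟨v, hv⟩ := hdvd2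
        have huv : u * v = 1 := by
          have : x * (u * v) = x * 1 := by rw [mul_one, ← mul_assoc, ← hu, ← hv]
          exact mul_left_cancel₀ hx this
        have hu1 : u = 1 ∨ u = -1 := Int.eq_one_or_neg_one_of_mul_eq_one huv
        refine ⟨u, hu1, by rw [hu, mul_comm], ?_⟩
        have : x * (g 1 0 : ℤ) = x * (u * y) := by rw [← hcross, hu]; ring
        exact mul_left_cancel₀ hx this
    -- replace `γ′` by `-γ′` if `u = -1`, so that the first columns agree mod `N` on the nose
    have key : ∀ γ₁ : SL(2, ℤ), (γ₁ 1 0 : ℤ) ≠ 0 →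
        ((γ₁ 0 0 : ℤ) : ZMod N) = ((γ'' 0 0 : ℤ) : ZMod N) → ((γ₁ 1 0 : ℤ) : ZMod N) = ((γ'' 1 0 : ℤ) : ZMod N) →
        ((γ₁ 0 0 : ℤ) : ℚ) / ((γ₁ 1 0 : ℤ) : ℚ) = ((γ' 0 0 : ℤ) : ℚ) / ((γ' 1 0 : ℤ) : ℚ) →
        D.uniformize ((D.c : ℂ) * modularSymbol D.f (((γ' 0 0 : ℤ) : ℚ) / ((γ' 1 0 : ℤ) : ℚ))) =
          D.uniformize ((D.c : ℂ) * modularSymbol D.f (((γ'' 0 0 : ℤ) : ℚ) / ((γ'' 1 0 : ℤ) : ℚ))) := by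
      intro γ₁ hγ₁10 e0 e1 hq
      obtain ⟨η, t, hηΓ, hη⟩ := exists_gamma_mul_eq_mul_T_zpow (N := N) γ₁ γ'' e0 e1
      have hη0 : η ∈ Gamma0 N := Gamma1_in_Gamma0 N (Gamma_le_Gamma1 N hηΓ)
      rw [← hq]
      exact uniformize_cusp_eq_of_gamma0 D γ₁ γ'' hγ₁10 hγ''10 ⟨η, hη0⟩ t hη
    rcases hu1 with hu | hu
    · refine key γ' hγ'10 ?_ ?_ rfl
      · rw [h00, hux, hu, one_mul]; simp [hγ''def]
      · rw [h10, huy, hu, one_mul]; simp [hγ''def]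
    · refine key (-γ') (by simpa using hγ'10) ?_ ?_ ?_
      · have : (((-γ') 0 0 : ℤ) : ZMod N) = -((γ' 0 0 : ℤ) : ZMod N) := by simp
        rw [this, h00, hux, hu]; simp [hγ''def]
      · have : (((-γ') 1 0 : ℤ) : ZMod N) = -((γ' 1 0 : ℤ) : ZMod N) := by simp
        rw [this, h10, huy, hu]; push_cast; simp [hγ''def]
      · have e0 : (((-γ') 0 0 : ℤ) : ℚ) = -((γ' 0 0 : ℤ) : ℚ) := by simp
        have e1 : (((-γ') 1 0 : ℤ) : ℚ) = -((γ' 1 0 : ℤ) : ℚ) := by simp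
        rw [e0, e1, neg_div_neg_eq]

end Summit.BirchSwinnertonDyer.BirchSwinnertonDyer.Theorems.ManinLocalTwoThree.StevensGalois

end
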